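/-
Copyright: statement-level skeleton of a published paper (lit-balaban cell, Phase-2 proof seat p39 gen 6). No proof claims
beyond what the kernel checks below.
-/
import Literature.MathematicalPhysics.QuantumFieldTheory.Balaban1983to89.B3GkZeroTorusRescaled
import Literature.MathematicalPhysics.QuantumFieldTheory.Balaban1983to89.B3CxiTorusBound

/-!
# B3 — T. Bałaban, *(Higgs)₂,₃ quantum fields in a finite volume. III. Renormalization*, CMP **88** (1983) 411–445
[Balaban1983Higgs3], p. 437 [PDF 27]: the RESOLVENT IDENTITY of (3.16) — *"Next we replace G^ξ_{j″}(0) by C^ξ = (−Δ^ξ + 1)^{−1}: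
G^ξ_{j″}(0) = C^ξ + G^ξ_{j″}(0)(1 − m²_{j″} − a_{j″}P_{j″})C^ξ"* — PROVED AS A KERNEL IDENTITY for the zero-field torus MODEL INSTANCE
(`G^ξ_{j″}(0)` = the rescaled torus propagator `B3GkZeroTorusRescaled.G0xi`, `C^ξ` = p03's torus free propagator `B3CxiTorusBound.CxiT`),
together with the kernel formula for the mixed second difference `(∂^ξ_νM∂^{ξ*}_ν)(y,y′)` of `M := G^ξ_{j″}(0) − C^ξ` that p20's
`B3Bound316.abs_bracket316_le` takes as the subject of its hypothesis `hM`

statement-level skeleton of published theorems with citation tags; proofs where landed; nothing here is a claim about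
the Yang–Mills mass gap

PDF held: `paper:balaban1983-higgs-2-3-quantum-fields-finite-volume` (journal page = PDF page + 410); p. 437 [PDF 27] read in
the OCR text (`p0027.txt`).  Row **B3.Eq3.11-3.17** of `HOME/lit-balaban-r15/ROWS-B3.md` (fold owner r15), sub-display (3.16).
THIS FILE is file 3 of this seat's gen-6 discharge of `hM` at the zero-field torus instance (file 1 `B3KernelConvolutionTorus`,
file 2 `B3GkZeroTorusRescaled`, file 4 `B3Bound316ZeroTorus`).  Inputs used BY NAME: r02's `B5Display136Torus.Grs` /
`G_eq_smul_Grs` (`G_k = (L^kε)²·G_k^{resc}`, `G_k^{resc} = (−Δ^ξ + (L^kε)²m² + a_kQ_k^*Q_k)^{−1}`, `ξ = ε/(L^kε)`) and p38's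
`B4Ineq115Torus.Marg` / `Grs_mul_Marg` (the argument of that inverse and `G^{resc}·Marg = 1`); p03's `CxiT`, `laplace_CxiT_add`
(`(−Δ^ξ_T + 1)C^ξ_T(·,y′) = ξ^{−d}δ_{y′}`), `CxiT_symm`; r15's `dKernel`/`d1Kernel` ((3.9)/(3.23) kernels) and p20 g5's
`B3Ineq210MixedTorus.mixedT` (`∂_μ·M·∂_νᵀ`); the tower dictionary of `B1RG242Torus` (`hOp`, `deriv`, `Qk`/`Qks` = `avgMat`/`extMat`).
* §1 LATTICE-OPERATOR DICTIONARY: `(−Δ^s + m²)f = m²f + Δ_{LFC}f` (`hOp_mulVec_eq_laplace`: the matrix `B1RG242Torus.hOp` acts as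
  r15's `LatticeFieldCalculus.laplace`), hence **`hOp_mul_CxiT`**: `(−Δ^ξ + 1)·C^ξ_T = ξ^{−d}·1` as matrices.
* §2 **`G0xi_eq_Grs`**: `G^ξ_k(0) = ξ^{−d}·G_k^{resc}` and **`G0xi_mul_Marg`**: `G^ξ_k(0)·(−Δ^ξ + (L^kε)²m² + a_kP_k) = ξ^{−d}·1`
  (`ξ = L^{−k}` is `P.eta k = ε/(L^kε)`, `eta_eq_div`).
* §3 THE PROJECTION `P_k = Q_k^*Q_k` ON THE `ξ`-LATTICE: `P_k(z,z′) = ξ^d·[z, z′ in the same k-block]` (`Pk_apply`), so `|P_k(z,z′)| ≤ ξ^d`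
  and `P_k(z,z′) ≠ 0 ⇒ ξ|z − z′|_∞ ≤ 2` (`Pk_abs_le`, `eta_supDist_le_two_of_Pk_ne_zero`: a k-block has diameter `< L^k` lattice steps,
  `B5Ineq137Torus.T_blk_le`, and `T = supDist`, `B3Bound323ZeroTorus.T_eq_supDist`).
* §4 **THE RESOLVENT IDENTITY (3.16) AT THE INSTANCE** (`resolvent316_zeroTorus`): with `D := (−Δ^ξ + 1) − (−Δ^ξ + (L^kε)²m² + a_kP_k)
  = (1 − (L^kε)²m²)·1 − a_kP_k` (`hOp_one_sub_Marg`), `G^ξ_k(0) − C^ξ_T = ξ^d·G^ξ_k(0)·D·C^ξ_T` as matrices — the printed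
  `G^ξ_{j″}(0) = C^ξ + G^ξ_{j″}(0)(1 − m²_{j″} − a_{j″}P_{j″})C^ξ` with `m²_{j″} = (L^{j″}η)²m²` (operators composed with the `ξ^d`-weighted
  sums, whence the factor `ξ^d` between `ξ^d`-normalised kernels); entrywise `Mxi_apply`.
* §5 **THE DERIVATIVE KERNEL OF `M`** (`dKernel_Mxi`): `(∂^ξ_νM∂^{ξ*}_ν)(y,y′) = ξ^d·Σ_{z,z′}(∂^ξ_νG^ξ_k(0))(y,z)·D(z,z′)·(∂^ξ_νC^ξ_T)(y′,z′)`
  (the column difference of the symmetric `C^ξ_T` is its row difference at swapped arguments), and the split of `D` into its diagonal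
  part and `−a_kP_k` (`dKernel_Mxi_split`) — the form fed to `B3KernelConvolutionTorus.conv_le_offdiag` / `conv_block_le` in file 4.
HONEST SCOPE: the model instance `A = B̃ = 0`, `U ≡ 1`, `Ω` = the whole torus; `1 ≤ k ≤ m + K` (Bałaban's levels; the blocks of `Q_k`
are the printed ones there); all dimensions `d`.  Mathlib + the cited tree files; TWO `def`s with bodies (`Mxi := G0xi − CxiT`, `Dmid := (1 − (L^kε)²m²)·1 − a_kP_k`), no named
facts; standard axioms.  Unit `lit-balaban-p39-g6` (Phase-2 proof seat p39, gen 6), HOME `run/shared/lean/pub/lit-balaban/`, 2026-08-21.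
-/

open scoped BigOperators

namespace Literature.MathematicalPhysics.QuantumFieldTheory.Balaban1983to89.B3Eq316ResolventZeroTorus

open Matrix Finset B1RG242Torus B5Display136Torus B4Ineq115Torus B5Ineq137Torus B3GkZeroTorusRescaled
open LatticeFieldCalculus B3Sect3ScalarSelfEnergy B3TorusRadialSums B3CxiTorusBound
open B3Ineq210MixedTorus (mixedT mixedT_apply)

noncomputable section

variable {P : Params}

/-! ## §1 The matrix `hOp` acts as the lattice Laplacian of `LatticeFieldCalculus` -/

section Dictionary

variable {i : ℕ}

/-- kernel: `(y − e_μ) + e_μ = y`. [folklore] -/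
private theorem shift_unshift' (y : Site P i) (μ : Fin P.d) : (y.unshift μ).shift μ = y :=
  (shiftEquiv (P := P) (j := i) μ).apply_symm_apply y

/-- kernel: `(y + e_μ) − e_μ = y`. [folklore] -/
private theorem unshift_shift' (y : Site P i) (μ : Fin P.d) : (y.shift μ).unshift μ = y :=
  (shiftEquiv (P := P) (j := i) μ).symm_apply_apply y

/-- kernel: `x = x′ + e_μ ↔ x′ = x − e_μ`. [folklore] -/
private theorem eq_shift_iff (x x' : Site P i) (μ : Fin P.d) : x = x'.shift μ ↔ x' = x.unshift μ := by
  constructor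
  · rintro rfl; rw [unshift_shift']
  · rintro rfl; rw [shift_unshift']

/-- kernel: the transposed shift matrix shifts backwards, `(S_μᵀg)(x) = g(x − e_μ)`. [folklore] -/
private theorem shiftMat_transpose_mulVec (μ : Fin P.d) (g : Site P i → ℝ) (x : Site P i) :
    ((shiftMat P i μ)ᵀ *ᵥ g) x = g (x.unshift μ) := by
  simp only [Matrix.mulVec, dotProduct, Matrix.transpose_apply, shiftMat, ite_mul, one_mul, zero_mul]
  simp_rw [eq_shift_iff x _ μ]
  rw [Finset.sum_ite_eq', if_pos (Finset.mem_univ _)]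

/-- kernel: `(∂^{sᵀ}_μ g)(x) = s^{−1}(g(x − e_μ) − g(x))` — the transposed forward difference is the backward one. [folklore] -/
private theorem transpose_deriv_mulVec (s : ℝ) (μ : Fin P.d) (g : Site P i → ℝ) (x : Site P i) :
    ((deriv P i s μ)ᵀ *ᵥ g) x = s⁻¹ * (g (x.unshift μ) - g x) := by
  rw [B1RG242Torus.deriv, Matrix.transpose_smul, Matrix.transpose_sub, Matrix.transpose_one, Matrix.smul_mulVec,
    Matrix.sub_mulVec, Matrix.one_mulVec, Pi.smul_apply, Pi.sub_apply, shiftMat_transpose_mulVec, smul_eq_mul]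

/-- **`(−Δ^s + m²)f = m²f + Δf`**: the matrix `−Δ^s + m² = m²·1 + Σ_μ(∂^s_μ)ᵀ∂^s_μ` of the tower (`B1RG242Torus.hOp`, B1 (1.11)) acts on
site functions as `m²` plus r15's positive lattice Laplacian `LatticeFieldCalculus.laplace` with `c = s⁻¹` ([B5] (1.21)) — the two
transcriptions of the torus Laplace operator agree. [cite: Balaban1982Higgs1, (1.11) p.605] -/
theorem hOp_mulVec_eq_laplace (s msq : ℝ) (f : Site P i → ℝ) (x : Site P i) :
    (hOp P i s msq *ᵥ f) x = msq * f x + laplace s⁻¹ f x := by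
  rw [hOp_mulVec, Pi.add_apply, Pi.smul_apply, Finset.sum_apply, smul_eq_mul, laplace]
  congr 1
  refine Finset.sum_congr rfl fun μ _ => ?_
  rw [transpose_deriv_mulVec, deriv_mulVec, deriv_mulVec, shift_unshift', smul_eq_mul]
  ring

end Dictionary

/-- **`(−Δ^ξ + 1)·C^ξ_T = ξ^{−d}·1`** as matrices on the torus: the defining equation of the free propagator (p03's `laplace_CxiT_add`,
*"C^ξ = (−Δ^ξ + 1)^{−1}"* with the `ξ^d`-weighted sums) read through §1 for the tower's matrix `hOp P j ξ 1`.
[cite: Balaban1983Higgs3, (3.16) p.437] -/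
theorem hOp_mul_CxiT {j : ℕ} {ξ : ℝ} (hξ : 0 < ξ) :
    hOp P j ξ 1 * Matrix.of (CxiT (P := P) (j := j) ξ) = (ξ ^ P.d)⁻¹ • (1 : Matrix (Site P j) (Site P j) ℝ) := by
  ext y y'
  rw [Matrix.mul_apply', Matrix.smul_apply, Matrix.one_apply, smul_eq_mul, mul_ite, mul_one, mul_zero]
  change (hOp P j ξ 1 *ᵥ fun z => CxiT ξ z y') y = _
  rw [hOp_mulVec_eq_laplace, one_mul, add_comm, laplace_CxiT_add hξ y y', inv_pow]

/-! ## §2 `G^ξ_k(0) = ξ^{−d}·G_k^{resc}` and its operator equation -/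

section Tower

variable (P)

/-- `ξ = L^{−k} = ε/(L^kε)`: the tree's two spellings of the rescaled spacing (`Params.eta`, and the argument of `B5Display136Torus.Grs`).
[cite: Balaban1983Higgs3, (3.16) p.437] -/
theorem eta_eq_div (k : ℕ) : P.eta k = P.eps / P.spacing k := by
  rw [eq_div_iff (P.spacing_pos k).ne', mul_comm, spacing_mul_eta]

/-- **`M := G^ξ_k(0) − C^ξ_T`**, the difference kernel of (3.16) at the zero-field torus instance (`ξ = L^{−k}`).
[cite: Balaban1983Higgs3, (3.16) p.437] -/
def Mxi (a msq : ℝ) (k : ℕ) : Kernel P 0 := fun y y' => G0xi P a msq k y y' - CxiT (P.eta k) y y'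

/-- **`D := (1 − m²_{j″})·1 − a_{j″}P_{j″}`**, the middle operator of (3.16) at the instance (`m²_{j″} = (L^kε)²m²`, `a_{j″} = a_k`,
`P_{j″} = Q_k^*Q_k`), as a matrix on `T^{(0)}`. [cite: Balaban1983Higgs3, (3.16) p.437] -/
def Dmid (a msq : ℝ) (k : ℕ) : Matrix (Site P 0) (Site P 0) ℝ :=
  (1 - P.spacing k ^ 2 * msq) • (1 : Matrix (Site P 0) (Site P 0) ℝ) - B1.aSeq a P.L k • (Qks P k * Qk P k)

/-- Entries of `D`: `D(z,z′) = (1 − (L^kε)²m²)[z = z′] − a_kP_k(z,z′)`. [cite: Balaban1983Higgs3, (3.16) p.437] -/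
theorem Dmid_apply (a msq : ℝ) (k : ℕ) (z z' : Site P 0) :
    Dmid P a msq k z z' = (1 - P.spacing k ^ 2 * msq) * (if z = z' then 1 else 0) - B1.aSeq a P.L k * (Qks P k * Qk P k) z z' := by
  rw [Dmid, Matrix.sub_apply, Matrix.smul_apply, Matrix.smul_apply, Matrix.one_apply, smul_eq_mul, smul_eq_mul]

variable {P}

/-- **`G^ξ_k(0) = ξ^{−d}·G_k^{resc}`**: the rescaled kernel is `ξ^{−d}` times r02's rescaled operator
`Grs = (−Δ^ξ + (L^kε)²m² + a_kQ_k^*Q_k)^{−1}` (`G_k = (L^kε)²·Grs`, `B5Display136Torus.G_eq_smul_Grs`). [cite: Balaban1983Higgs3, (3.16) p.437] -/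
theorem G0xi_eq_Grs {a msq : ℝ} (ha : 0 < a) (hm : 0 ≤ msq) {k : ℕ} (hk : 1 ≤ k) (y y' : Site P 0) :
    G0xi P a msq k y y' = (P.eta k ^ P.d)⁻¹ * Grs P a msq k y y' := by
  unfold G0xi
  rw [G_eq_smul_Grs ha hm hk, Matrix.smul_apply, smul_eq_mul, ← mul_assoc ((P.spacing k ^ 2)⁻¹),
    inv_mul_cancel₀ (pow_ne_zero 2 (P.spacing_pos k).ne'), one_mul]

/-- The same as matrices. [cite: Balaban1983Higgs3, (3.16) p.437] -/
theorem G0xi_eq_smul_Grs {a msq : ℝ} (ha : 0 < a) (hm : 0 ≤ msq) {k : ℕ} (hk : 1 ≤ k) :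
    Matrix.of (G0xi P a msq k) = (P.eta k ^ P.d)⁻¹ • Grs P a msq k := by
  ext y y'
  rw [Matrix.of_apply, Matrix.smul_apply, smul_eq_mul]
  exact G0xi_eq_Grs ha hm hk y y'

/-- The argument of `G_k^{resc}` in the spelling `ξ = P.eta k`: `Marg = (−Δ^ξ + (L^kε)²m²) + a_k·Q_k^*Q_k`.
[cite: Balaban1982Higgs1, (2.22) p.610] -/
theorem Marg_eq (a msq : ℝ) (k : ℕ) :
    Marg P a msq k = hOp P 0 (P.eta k) (P.spacing k ^ 2 * msq) + B1.aSeq a P.L k • (Qks P k * Qk P k) := by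
  rw [Marg, eta_eq_div]

/-- **`G^ξ_k(0)·(−Δ^ξ + (L^kε)²m² + a_kP_k) = ξ^{−d}·1`**: the operator equation of the rescaled propagator (B1 (2.20) rescaled; p38's
`Grs_mul_Marg`). [cite: Balaban1982Higgs1, (2.20) p.610] -/
theorem G0xi_mul_Marg {a msq : ℝ} (ha : 0 < a) (hm : 0 ≤ msq) {k : ℕ} (hk : 1 ≤ k) :
    Matrix.of (G0xi P a msq k) * Marg P a msq k = (P.eta k ^ P.d)⁻¹ • (1 : Matrix (Site P 0) (Site P 0) ℝ) := by
  rw [G0xi_eq_smul_Grs ha hm hk, Matrix.smul_mul, Grs_mul_Marg ha hm hk]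

end Tower

/-! ## §3 The projection `P_k = Q_k^*Q_k` on the `ξ`-lattice -/

section Projection

/-- **`P_k(z,z′) = ξ^d·[z and z′ lie in the same k-block]`** (`ξ^d = L^{−kd}`): the matrix of `Q_k^*Q_k` for Bałaban's levels `k ≤ m + K`
(`Q_k` = `L^{−kd}Σ_{B^k(y)}`, `Q_k^*` = block-constant extension). [cite: Balaban1982Higgs1, (2.20) p.610] -/
theorem Pk_apply {k : ℕ} (hk : k ≤ P.m + P.K) (z z' : Site P 0) :
    (Qks P k * Qk P k) z z' = if Site.proj k k z' = Site.proj k k z then P.eta k ^ P.d else 0 := by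
  rw [Qks, Qk, lvl_of_le P hk, Matrix.mul_apply, eta_pow_eq]
  simp only [extMat, avgMat, ite_mul, one_mul, zero_mul]
  rw [Finset.sum_ite_eq, if_pos (Finset.mem_univ _)]

/-- `|P_k(z,z′)| ≤ ξ^d`. [cite: Balaban1982Higgs1, (2.20) p.610] -/
theorem Pk_abs_le {k : ℕ} (hk : k ≤ P.m + P.K) (z z' : Site P 0) : |(Qks P k * Qk P k) z z'| ≤ P.eta k ^ P.d := by
  rw [Pk_apply hk]
  have h0 : 0 ≤ P.eta k ^ P.d := pow_nonneg (eta_pos P k).le _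
  split_ifs
  · rw [abs_of_nonneg h0]
  · rw [abs_zero]; exact h0

/-- Sites of a common k-block are within `2(L^k − 1)` lattice steps in the sup torus distance (each is within `L^k − 1` of the
block's corner representative: `B5Ineq137Torus.T_blk_le`; `T = supDist`). [cite: Balaban1982Higgs1, (1.17) p.606] -/
theorem supDist_le_of_proj_eq {k : ℕ} (hk : k ≤ P.m + P.K) {z z' : Site P 0} (h : Site.proj k k z' = Site.proj k k z) :
    (supDist z z' : ℝ) ≤ 2 * ((P.L : ℝ) ^ k - 1) := by
  rw [← B3Bound323ZeroTorus.T_eq_supDist P]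
  have h1 := T_blk_le P hk z
  have h2 := T_blk_le P hk z'
  rw [B5Leaf235Torus.blk_eq_proj hk] at h1 h2
  rw [h] at h2
  have t := T_triangle P 0 z (fine P k (Site.proj k k z)) z'
  have hs := T_symm P 0 z' (fine P k (Site.proj k k z))
  linarith

/-- **`P_k(z,z′) ≠ 0 ⇒ ξ|z − z′|_∞ ≤ 2`**: on the `ξ = L^{−k}`-lattice the k-blocks are unit cubes — the support hypothesis `hEs` of
`B3KernelConvolutionTorus.conv_block_le`. [cite: Balaban1982Higgs1, (1.17) p.606] -/
theorem eta_supDist_le_two_of_Pk_ne_zero {k : ℕ} (hk : k ≤ P.m + P.K) {z z' : Site P 0} (h : (Qks P k * Qk P k) z z' ≠ 0) :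
    P.eta k * (supDist z z' : ℝ) ≤ 2 := by
  rw [Pk_apply hk] at h
  have hproj : Site.proj k k z' = Site.proj k k z := by
    by_contra hne; exact h (if_neg hne)
  have hd := supDist_le_of_proj_eq hk hproj
  have hLk : 0 < (P.L : ℝ) ^ k := pow_pos P.cast_L_pos k
  rw [eta_eq_inv_pow]
  calc ((P.L : ℝ) ^ k)⁻¹ * (supDist z z' : ℝ) ≤ ((P.L : ℝ) ^ k)⁻¹ * (2 * ((P.L : ℝ) ^ k - 1)) :=
        mul_le_mul_of_nonneg_left hd (inv_nonneg.mpr hLk.le)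
    _ = 2 * (1 - ((P.L : ℝ) ^ k)⁻¹) := by field_simp
    _ ≤ 2 := by nlinarith [inv_nonneg.mpr hLk.le]

end Projection

/-! ## §4 The resolvent identity of (3.16) at the zero-field torus instance -/

section Resolvent

/-- `D := (−Δ^ξ + 1) − (−Δ^ξ + (L^kε)²m² + a_kP_k) = (1 − (L^kε)²m²)·1 − a_k·P_k` — the middle operator `(1 − m²_{j″} − a_{j″}P_{j″})`
of (3.16). [cite: Balaban1983Higgs3, (3.16) p.437] -/
theorem hOp_one_sub_Marg (a msq : ℝ) (k : ℕ) : hOp P 0 (P.eta k) 1 - Marg P a msq k = Dmid P a msq k := by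
  rw [Marg_eq, hOp, hOp, Dmid, sub_smul, one_smul]
  abel

/-- **THE RESOLVENT IDENTITY (3.16) FOR THE ZERO-FIELD TORUS INSTANCE, as matrices**: `G^ξ_k(0) − C^ξ_T =
ξ^d·G^ξ_k(0)·[(1 − (L^kε)²m²)·1 − a_kP_k]·C^ξ_T` — the printed *"G^ξ_{j″}(0) = C^ξ + G^ξ_{j″}(0)(1 − m²_{j″} − a_{j″}P_{j″})C^ξ"* with
`m²_{j″} = (L^{j″}η)²m²`, the operators being the `ξ^d`-weighted sums of their kernels (whence `ξ^d` between two `ξ^d`-normalised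
kernels).  Proof: `G(0)·[(−Δ^ξ+1) − Marg]·C = G(0)·(−Δ^ξ+1)·C − G(0)·Marg·C = ξ^{−d}G(0) − ξ^{−d}C` (`hOp_mul_CxiT`, `G0xi_mul_Marg`).
[cite: Balaban1983Higgs3, (3.16) p.437] -/
theorem resolvent316_zeroTorus {a msq : ℝ} (ha : 0 < a) (hm : 0 ≤ msq) {k : ℕ} (hk : 1 ≤ k) :
    Matrix.of (Mxi P a msq k) =
      P.eta k ^ P.d • (Matrix.of (G0xi P a msq k) * Dmid P a msq k * Matrix.of (CxiT (P := P) (j := 0) (P.eta k))) := by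
  have hη : 0 < P.eta k := eta_pos P k
  have hηd : P.eta k ^ P.d ≠ 0 := pow_ne_zero _ hη.ne'
  have hM : Matrix.of (Mxi P a msq k) = Matrix.of (G0xi P a msq k) - Matrix.of (CxiT (P := P) (j := 0) (P.eta k)) := by
    ext y y'; rfl
  rw [hM, ← hOp_one_sub_Marg, Matrix.mul_sub, Matrix.sub_mul, Matrix.mul_assoc, hOp_mul_CxiT hη, G0xi_mul_Marg ha hm hk,
    Matrix.mul_smul, Matrix.mul_one, Matrix.smul_mul, Matrix.one_mul, ← smul_sub, smul_smul, mul_inv_cancel₀ hηd, one_smul]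

/-- The identity entrywise: `M(y,y′) = ξ^d·Σ_{z′}(Σ_z G^ξ_k(0)(y,z)·D(z,z′))·C^ξ_T(z′,y′)` with
`D(z,z′) = (1 − (L^kε)²m²)[z = z′] − a_kP_k(z,z′)`. [cite: Balaban1983Higgs3, (3.16) p.437] -/
theorem Mxi_apply {a msq : ℝ} (ha : 0 < a) (hm : 0 ≤ msq) {k : ℕ} (hk : 1 ≤ k) (y y' : Site P 0) :
    Mxi P a msq k y y' = P.eta k ^ P.d * ∑ z' : Site P 0, (∑ z : Site P 0, G0xi P a msq k y z * Dmid P a msq k z z') *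
        CxiT (P.eta k) z' y' := by
  have h := congr_fun (congr_fun (resolvent316_zeroTorus (P := P) ha hm hk) y) y'
  rw [Matrix.of_apply, Matrix.smul_apply, smul_eq_mul, Matrix.mul_apply] at h
  simp only [Matrix.mul_apply, Matrix.of_apply] at h
  exact h

end Resolvent

/-! ## §5 The mixed second difference of `M` -/

section Derivative

/-- kernel: a right transposed derivative differentiates the column variable, `(N·(∂^s_ν)ᵀ)(x,y′) = s⁻¹(N(x,y′+e_ν) − N(x,y′))`.
[folklore] -/
private theorem mul_deriv_transpose_apply {ι : Type*} (s : ℝ) (ν : Fin P.d) (N : Matrix ι (Site P 0) ℝ) (x : ι)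
    (y' : Site P 0) : (N * (deriv P 0 s ν)ᵀ) x y' = s⁻¹ * (N x (y'.shift ν) - N x y') := by
  rw [show N * (deriv P 0 s ν)ᵀ = (deriv P 0 s ν * Nᵀ)ᵀ by rw [Matrix.transpose_mul, Matrix.transpose_transpose],
    Matrix.transpose_apply, B5Leaf235Torus.deriv_mul_apply]
  rfl

/-- r15's mixed second-difference kernel `dKernel s⁻¹ ν K` ((3.9): `(∂_νK∂_ν^*)(x,x′)`) is p20's matrix `mixedT s ν ν K = ∂_ν·K·∂_νᵀ`.
[cite: Balaban1983Higgs3, (3.9) p.435] -/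
theorem dKernel_eq_mixedT (s : ℝ) (ν : Fin P.d) (K : Kernel P 0) (x x' : Site P 0) :
    dKernel s⁻¹ ν K x x' = mixedT P s ν ν K x x' := by
  rw [mixedT_apply, dKernel, pow_two]

/-- r15's row-difference kernel `d1Kernel s⁻¹ ν K` ((3.23): `(∂_νK)(x,x′)`) is the matrix `∂_ν·K`. [cite: Balaban1983Higgs3, (3.23) p.439] -/
theorem d1Kernel_eq_deriv_mul (s : ℝ) (ν : Fin P.d) (K : Kernel P 0) (x x' : Site P 0) :
    d1Kernel s⁻¹ ν K x x' = (deriv P 0 s ν * Matrix.of K) x x' := by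
  rw [B5Leaf235Torus.deriv_mul_apply, d1Kernel]
  rfl

/-- The column difference of the symmetric `C^ξ_T` is its row difference at swapped arguments:
`(C^ξ_T·∂_νᵀ)(z′,y′) = (∂_νC^ξ_T)(y′,z′)`. [cite: Balaban1983Higgs3, (3.16) p.437] -/
theorem CxiT_mul_deriv_transpose_apply (ξ : ℝ) (ν : Fin P.d) (z' y' : Site P 0) :
    (Matrix.of (CxiT (P := P) (j := 0) ξ) * (deriv P 0 ξ ν)ᵀ) z' y' = d1Kernel ξ⁻¹ ν (CxiT ξ) y' z' := by
  rw [mul_deriv_transpose_apply, Matrix.of_apply, Matrix.of_apply, d1Kernel, CxiT_symm ξ z' (y'.shift ν), CxiT_symm ξ z' y']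

/-- **THE DERIVATIVE KERNEL OF `M`** (the subject of `hM` in `B3Bound316.abs_bracket316_le`): for every `ν, y, y′`,
`(∂^ξ_νM∂^{ξ*}_ν)(y,y′) = ξ^d·Σ_{z′}(Σ_z(∂^ξ_νG^ξ_k(0))(y,z)·D(z,z′))·(∂^ξ_νC^ξ_T)(y′,z′)`, `D = (1 − (L^kε)²m²)·1 − a_kP_k` — the
differences go onto the outer factors of the resolvent identity (`∂_ν·(ξ^dG(0)DC)·∂_νᵀ = ξ^d(∂_νG(0))·D·(C∂_νᵀ)`).
[cite: Balaban1983Higgs3, (3.16) p.437] -/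
theorem dKernel_Mxi {a msq : ℝ} (ha : 0 < a) (hm : 0 ≤ msq) {k : ℕ} (hk : 1 ≤ k) (ν : Fin P.d) (y y' : Site P 0) :
    dKernel (P.eta k)⁻¹ ν (Mxi P a msq k) y y' = P.eta k ^ P.d *
      ∑ z' : Site P 0, (∑ z : Site P 0, d1Kernel (P.eta k)⁻¹ ν (G0xi P a msq k) y z * Dmid P a msq k z z') *
          d1Kernel (P.eta k)⁻¹ ν (CxiT (P.eta k)) y' z' := by
  rw [dKernel_eq_mixedT, mixedT]
  have hM : Matrix.of (Mxi P a msq k) =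
      P.eta k ^ P.d • (Matrix.of (G0xi P a msq k) * Dmid P a msq k * Matrix.of (CxiT (P := P) (j := 0) (P.eta k))) :=
    resolvent316_zeroTorus ha hm hk
  have hof : (Mxi P a msq k : Matrix (Site P 0) (Site P 0) ℝ) = Matrix.of (Mxi P a msq k) := rfl
  rw [hof, hM, Matrix.mul_smul, Matrix.smul_mul, Matrix.smul_apply, smul_eq_mul]
  congr 1
  rw [show deriv P 0 (P.eta k) ν * (Matrix.of (G0xi P a msq k) * Dmid P a msq k *
      Matrix.of (CxiT (P := P) (j := 0) (P.eta k))) * (deriv P 0 (P.eta k) ν)ᵀ =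
      (deriv P 0 (P.eta k) ν * Matrix.of (G0xi P a msq k)) * Dmid P a msq k *
      (Matrix.of (CxiT (P := P) (j := 0) (P.eta k)) * (deriv P 0 (P.eta k) ν)ᵀ) by simp only [Matrix.mul_assoc]]
  rw [Matrix.mul_apply]
  refine Finset.sum_congr rfl fun z' _ => ?_
  rw [CxiT_mul_deriv_transpose_apply, Matrix.mul_apply]
  congr 1
  refine Finset.sum_congr rfl fun z _ => ?_
  rw [d1Kernel_eq_deriv_mul]

/-- **The same, split into the diagonal part of `D` and the `P_k` part** — the two sums that `B3KernelConvolutionTorus.conv_le_offdiag`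
and `conv_block_le` estimate: `(∂^ξ_νM∂^{ξ*}_ν)(y,y′) = ξ^d·[(1 − (L^kε)²m²)·Σ_z(∂G(0))(y,z)(∂C)(y′,z) −
a_k·Σ_zΣ_{z′}(∂G(0))(y,z)P_k(z,z′)(∂C)(y′,z′)]`. [cite: Balaban1983Higgs3, (3.16) p.437] -/
theorem dKernel_Mxi_split {a msq : ℝ} (ha : 0 < a) (hm : 0 ≤ msq) {k : ℕ} (hk : 1 ≤ k) (ν : Fin P.d) (y y' : Site P 0) :
    dKernel (P.eta k)⁻¹ ν (Mxi P a msq k) y y' = P.eta k ^ P.d *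
      ((1 - P.spacing k ^ 2 * msq) *
          ∑ z : Site P 0, d1Kernel (P.eta k)⁻¹ ν (G0xi P a msq k) y z * d1Kernel (P.eta k)⁻¹ ν (CxiT (P.eta k)) y' z -
        B1.aSeq a P.L k * ∑ z : Site P 0, ∑ z' : Site P 0, d1Kernel (P.eta k)⁻¹ ν (G0xi P a msq k) y z *
          (Qks P k * Qk P k) z z' * d1Kernel (P.eta k)⁻¹ ν (CxiT (P.eta k)) y' z') := by
  classical
  rw [dKernel_Mxi ha hm hk]
  congr 1
  set dG : Site P 0 → ℝ := fun z => d1Kernel (P.eta k)⁻¹ ν (G0xi P a msq k) y z with hdG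
  set dC : Site P 0 → ℝ := fun z => d1Kernel (P.eta k)⁻¹ ν (CxiT (P.eta k)) y' z with hdC
  set c₁ : ℝ := 1 - P.spacing k ^ 2 * msq with hc₁
  set c₂ : ℝ := B1.aSeq a P.L k with hc₂
  set Pk : Site P 0 → Site P 0 → ℝ := fun z z' => (Qks P k * Qk P k) z z' with hPk
  -- entries of `D`
  have hDz : ∀ z z' : Site P 0, Dmid P a msq k z z' = c₁ * (if z = z' then 1 else 0) - c₂ * Pk z z' :=
    fun z z' => Dmid_apply P a msq k z z'
  show ∑ z', (∑ z, dG z * Dmid P a msq k z z') * dC z' = c₁ * ∑ z, dG z * dC z - c₂ * ∑ z, ∑ z', dG z * Pk z z' * dC z'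
  simp_rw [hDz, mul_sub, Finset.sum_sub_distrib, sub_mul, Finset.sum_sub_distrib]
  congr 1
  · -- the diagonal part collapses the inner sum
    have hin : ∀ z' : Site P 0, ∑ z, dG z * (c₁ * if z = z' then (1 : ℝ) else 0) = c₁ * dG z' := by
      intro z'
      simp_rw [mul_ite, mul_one, mul_zero]
      rw [Finset.sum_ite_eq', if_pos (Finset.mem_univ _), mul_comm]
    simp_rw [hin]
    rw [Finset.mul_sum]
    exact Finset.sum_congr rfl fun z' _ => by ring
  · calc ∑ z', (∑ z, dG z * (c₂ * Pk z z')) * dC z'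
        = ∑ z', ∑ z, c₂ * (dG z * Pk z z' * dC z') := by
          refine Finset.sum_congr rfl fun z' _ => ?_
          rw [Finset.sum_mul]
          exact Finset.sum_congr rfl fun z _ => by ring
      _ = ∑ z, ∑ z', c₂ * (dG z * Pk z z' * dC z') := Finset.sum_comm
      _ = c₂ * ∑ z, ∑ z', dG z * Pk z z' * dC z' := by simp_rw [Finset.mul_sum]

end Derivative

end

end Literature.MathematicalPhysics.QuantumFieldTheory.Balaban1983to89.B3Eq316ResolventZeroTorus
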